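import Summits.BirchSwinnertonDyer.Rank1Residual.ManinAdditive.KatoShiftThreeLawsEdges
import Summits.BirchSwinnertonDyer.BirchSwinnertonDyer.Theorems.ManinLocalTwoThreePrimeClassGenerationThree
import HarnessLib

/-!
# Route `ManinLocalTwoThree`, crux C3 `ManinPrimeToThreeAtNine` (stmt-BirchSwinnertonDyer-22968), line `kato-shift-three`
# (es g6): the generation law E-es-19 `ShiftClassGenerationThree` is EQUIVALENT to its prime-classwise form — BY NAME
# over `AdmissiblePrime W N ℓ`, `shiftClassSpan`, `primeClass`, `epsSign` (line prover p3; helper, unconditional edge)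

Instantiating the `W`-free theorem `two_mul_mem_closure_primeClass_admissibleThree` (sibling file
`…PrimeClassGenerationThree`) at the signs `ε = epsSign W`:
* `two_mul_mem_closure_primeClass_admissiblePrime` — for `9 ∣ N` and every `ℓ₀`, `2Λ_f` lies in the subgroup generated
  by the prime classes `primeClass f ℓ a` over `{ℓ | ℓ₀ ≤ ℓ ∧ AdmissiblePrime W N ℓ}` (E-es-19's index set, verbatim);
* `shiftClassGenerationThree_iff_primeClasswise` — hence E-es-19 (some `m`, `3 ∤ m`, with `m·Λ_f` inside the span of
  the shift classes `{a/ℓ, 3a/ℓ}_f` over admissible `ℓ ≥ ℓ₀`) holds iff some `m`, `3 ∤ m`, puts `m·{0, a/ℓ}_f` in that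
  span for every admissible `ℓ ≥ ℓ₀`, `0 < a < ℓ` (`⟸` doubles `m`). The conjecture therefore lives entirely in the
  passage from the prime classes to the shift differences `A₃c − c`, not in generation.
Nothing about BSD, Manin's conjecture or E-es-19 itself is proved here.
-/

set_option autoImplicit false
set_option linter.dupNamespace false

noncomputable section

open scoped Classical MatrixGroups ModularForm

open CongruenceSubgroup WeierstrassCurve
  Literature.NumberTheory.EllipticCurves Literature.NumberTheory.EllipticCurves.ModularForms
  Summit.BirchSwinnertonDyer.Rank1Residual.ManinAdditive

namespace Summit.BirchSwinnertonDyer.BirchSwinnertonDyer.Theorems.ManinLocalTwoThree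

/-- The Legendre sign `epsSign W q` is `±1`. [folklore] -/
theorem epsSign_eq_one_or (W : WeierstrassCurve ℚ) [W.IsElliptic] (q : ℕ) :
    epsSign W q = 1 ∨ epsSign W q = -1 := by
  unfold epsSign
  split_ifs <;> simp

/-- **`2Λ_f` is generated by the prime classes over E-es-19's admissible primes**: for `9 ∣ N`, every `ℓ₀` and
every `z ∈ Λ_f`, `2z ∈ ⟨primeClass f ℓ a : ℓ₀ ≤ ℓ, AdmissiblePrime W N ℓ, 0 < a < ℓ⟩` (the `W`-free theorem
`two_mul_mem_closure_primeClass_admissibleThree` at `ε = epsSign W`). [folklore] -/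
theorem two_mul_mem_closure_primeClass_admissiblePrime (W : WeierstrassCurve ℚ) [W.IsElliptic] {N : ℕ} [NeZero N]
    (f : CuspForm (Gamma0 N) 2) (h9 : 3 ^ 2 ∣ N) (ℓ₀ : ℕ) {z : ℂ} (hz : z ∈ periodLattice f) :
    2 * z ∈ AddSubgroup.closure
      {z : ℂ | ∃ ℓ ∈ {ℓ : ℕ | ℓ₀ ≤ ℓ ∧ AdmissiblePrime W N ℓ}, ∃ a : ℕ, 0 < a ∧ a < ℓ ∧ z = primeClass f ℓ a} :=
  two_mul_mem_closure_primeClass_admissibleThree f (epsSign W) (epsSign_eq_one_or W)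
    (by norm_num at h9; exact h9) ℓ₀ hz

/-- **E-es-19 ⟺ its prime-classwise form.** `ShiftClassGenerationThree` (CONJECTURE E-es-19) holds iff, for the same
data, some `m` with `3 ∤ m` puts `m·{0, a/ℓ}_f` in the span of the shift classes over admissible `ℓ ≥ ℓ₀` for EVERY
admissible `ℓ ≥ ℓ₀` and `0 < a < ℓ`: `⟹` because prime classes are periods, `⟸` (with `2m`) by
`two_mul_mem_closure_primeClass_admissiblePrime`. Nothing is asserted about E-es-19 itself. [folklore] -/
theorem shiftClassGenerationThree_iff_primeClasswise :
    ShiftClassGenerationThree ↔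
      ∀ (W : WeierstrassCurve ℚ) [W.IsElliptic] {N : ℕ} [NeZero N] (f : CuspForm (Gamma0 N) 2) (ℓ₀ : ℕ),
        IsNewformOf W f → 3 ^ 2 ∣ N → W.HasIrreducibleModPGaloisRep 3 →
        ∃ m : ℕ, ¬ 3 ∣ m ∧ ∀ ℓ : ℕ, ℓ₀ ≤ ℓ → AdmissiblePrime W N ℓ → ∀ a : ℕ, 0 < a → a < ℓ →
          (m : ℂ) * primeClass f ℓ a ∈ shiftClassSpan f {ℓ | ℓ₀ ≤ ℓ ∧ AdmissiblePrime W N ℓ} := by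
  rw [shiftClassGenerationThree_iff]
  constructor
  · intro H W _ N _ f ℓ₀ hf h9 hirr
    obtain ⟨m, hm, hgen⟩ := H W f ℓ₀ hf h9 hirr
    refine ⟨m, hm, fun ℓ _ hadm a ha0 ha => hgen _ ?_⟩
    exact primeClass_mem_periodLattice_of_lt f hadm.1 hadm.2.1 ha0 ha
  · intro H W _ N _ f ℓ₀ hf h9 hirr
    obtain ⟨m, hm, hgen⟩ := H W f ℓ₀ hf h9 hirr
    refine ⟨2 * m, by omega, fun z hz => ?_⟩
    have h2 := two_mul_mem_closure_primeClass_admissiblePrime W f h9 ℓ₀ hz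
    have hmul : ((2 * m : ℕ) : ℂ) * z = (m : ℂ) * (2 * z) := by
      push_cast
      ring
    rw [hmul, ← AddMonoidHom.coe_mulLeft, ← AddSubgroup.mem_comap]
    refine (AddSubgroup.closure_le _).mpr ?_ h2
    rintro _ ⟨ℓ, hℓ, a, ha0, ha, rfl⟩
    rw [SetLike.mem_coe, AddSubgroup.mem_comap, AddMonoidHom.coe_mulLeft]
    exact hgen ℓ hℓ.1 hℓ.2 a ha0 ha

end Summit.BirchSwinnertonDyer.BirchSwinnertonDyer.Theorems.ManinLocalTwoThree

end
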